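import Summits.HodgeConjecture.HodgeConjecture.Theorems.LinearSystemTorelliMiddleDivisorSupportFourfoldOfDominantQbarEnvelope
import Summits.HodgeConjecture.HodgeConjecture.Theorems.LinearSystemTorelliMiddleDivisorSupportFourfoldStubDominantEnvelope
import Summits.HodgeConjecture.HodgeConjecture.Theorems.LinearSystemTorelliMiddleDivisorSupportFourfoldStubFiniteMonodromyAtGenericSpread

/-!
# Route `LinearSystemTorelli` — crux `MiddleDivisorSupportFourfold` (stmt-HodgeConjecture-2409) is
# downstream of route `PeriodDeficiency`: HGQ ∧ HC(ℚ̄) in codimension 2 suffice (kernel-checked)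

Helper file for the crux item stmt-HodgeConjecture-2409 (`--supports`; it closes nothing), line
`IdeatorFiveSketch` (idea `weakly-nonfactor-descent`), lead c3. It assembles the line's skeleton
(`Cruxes/MiddleDivisorSupportFourfold/Lines/IdeatorFiveSketch.lean`, v2) from what has LANDED:

* stub A reduced (p119481): `stub_finiteMonodromyAtGenericSpread_of_qbarGenericIsHodgeGeneric` —
  finite monodromy of every rational `(2,2)`-class at the `ℚ̄`-generic point of a `ℚ̄`-spread of the
  fourfold ⟸ `PeriodDeficiency.ClassicalGeometricVHS` (stmt-11597) ∧
  `PeriodDeficiency.QbarGenericIsHodgeGeneric` (stmt-11595) modulo the named fact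
  `bku_finite_monodromyOrbit_of_isHodgeGenericIn` (the spreading-out fact being PROVED,
  `spreadingOut_smoothProjective_qbarFamily_holds`);
* stub B proved (this session): `stub_dominantEnvelopeOfFiniteMonodromy` — finite monodromy at a
  `ℚ̄`-generic point ⟹ DOMINANT `ℚ̄`-envelope, from the named facts
  `FundamentalGroup.riemannExistence_qbarDescent_of_finiteIndex` (C) and `deligne_globalInvariantCycles` (D);
* stub E reduced (p117963): `linearSystemTorelli_qbarDivisorSupport_of_hodgeConjectureQbar` —
  `ℚ̄`-rational divisor support in codimension 2 ⟸ `PeriodDeficiency.HodgeConjectureQbar`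
  (stmt-11596) modulo the named fact `charlesSchnell2014_algebraicClasses_supportedOn_qbarClosed`;
* the glue (p117963): `linearSystemTorelli_middleDivisorSupportFourfold_of_dominantQbarEnvelope`
  (pull-back of the complement of a proper `ℚ̄`-closed subset along a dominant map — PROVED, no
  cycle class / Fulton Cor. 19.2 (b)).

Net statement (`linearSystemTorelli_middleDivisorSupportFourfold_of_periodDeficiency`):

  ClassicalGeometricVHS → QbarGenericIsHodgeGeneric → HodgeConjectureQbar →
    bku_finite_monodromyOrbit_of_isHodgeGenericIn → riemannExistence_qbarDescent_of_finiteIndex →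
    deligne_globalInvariantCycles → charlesSchnell2014_algebraicClasses_supportedOn_qbarClosed →
    MiddleDivisorSupportFourfold,

i.e. the crux of `LinearSystemTorelli` is kernel-checked DOWNSTREAM of the two open cruxes
stmt-11595 (a `ℚ̄`-generic point is Hodge-generic — KOU Conj. 1.5 (a), the transcendence kernel)
and stmt-11596 (the Hodge conjecture over `ℚ̄`; only its codimension-2 slice is used, see
`…_of_hcQbarCodimTwo`) of route `PeriodDeficiency`, its construction item stmt-11597, and four
classical named facts (BKU §3.2 / KOU §1.1; SGA1 XII 5.1 + XIII 4.6; Hodge II 4.1.1; Charles–Schnell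
Remark after Cor. 11.3.16) — with Fulton's pull-back of algebraic classes NOT among them.
-/

-- every declaration of this problem lives in `Summit.HodgeConjecture.HodgeConjecture.…`
set_option linter.dupNamespace false

noncomputable section

namespace Summit.HodgeConjecture.HodgeConjecture.Theorems

open CategoryTheory AlgebraicGeometry
open _root_.Topology
open Summit.HodgeConjecture.HodgeConjecture.Theses
open Literature.AlgebraicGeometry Literature.AlgebraicGeometry.Motives
open Literature.AlgebraicGeometry.HodgeTheory
open Literature.AlgebraicTopology.SingularHomology

/-- **Finite monodromy at the `ℚ̄`-generic spread point, all `(n, p)`** — the general form of the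
line's stub A (whose registered `(4,2)` instance is `stub_finiteMonodromyAtGenericSpread_of_qbarGenericIsHodgeGeneric`,
p119481): granted `ClassicalGeometricVHS` (stmt-11597), `QbarGenericIsHodgeGeneric` (stmt-11595)
and the named fact `bku_finite_monodromyOrbit_of_isHodgeGenericIn`, every rational `(p,p)` class on
a smooth projective complex `n`-fold has, on the `ℚ̄`-spread `X ≅ 𝒳_s` of
`spreadingOut_smoothProjective_qbarFamily_holds` (`s` over the generic point of the smooth
irreducible quasi-projective `ℚ̄`-base), a finite monodromy orbit: the `ℚ̄`-Zariski closure of `s`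
is everything (`IsDefinedOverQbar.eq_univ_of_closure_base_pt_eq_univ`), so `s` is Hodge-generic in
`S(ℂ)` and BKU applies. [cite: CharlesSchnell2014Notes, Thm. 11.3.19]
[cite: BaldiKlinglerUllmo2024, §3.2] -/
theorem linearSystemTorelli_finiteMonodromyAtGenericSpread_of_qbarGenericIsHodgeGeneric
    (hC : PeriodDeficiency.ClassicalGeometricVHS) (hG : PeriodDeficiency.QbarGenericIsHodgeGeneric)
    (hB : bku_finite_monodromyOrbit_of_isHodgeGenericIn) (σ : AlgebraicClosure ℚ →+* ℂ)
    {n : ℕ} {X : SchemeOver ℂ} (hX : IsSmoothProjective n X) (p : ℕ) (c : complexBetti X (2 * p))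
    (hc : IsRationalClass c) (hh : IsOfHodgeType n X (2 * p) p p c) :
    ∃ (𝒳₀ S₀ : SchemeOver (AlgebraicClosure ℚ)) (f₀ : 𝒳₀ ⟶ S₀)
      (s : ComplexPoints ((baseChangeHom σ).obj S₀))
      (e : X ≅ fiberOver ((baseChangeHom σ).map f₀) s),
      IsQuasiProjectiveOver 𝒳₀ ∧ IsQuasiProjectiveOver S₀ ∧ IrreducibleSpace S₀.left ∧
      AlgebraicGeometry.Smooth S₀.hom ∧
      IsSmoothProjectiveFamily ((baseChangeHom σ).map f₀) n ∧
      closure {(baseChangeHomFst σ S₀).base s.pt} = (Set.univ : Set S₀.left) ∧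
      {β : complexBetti (fiberOver ((baseChangeHom σ).map f₀) s) (2 * p) |
          ∃ γ : Path s s, IsContinuationAlong γ (complexBetti.map e.inv (2 * p) c) β}.Finite := by
  -- spread `X` out over `ℚ̄`: `e : X ≅ 𝒳_s`, `s` over the generic point of `S₀`
  obtain ⟨𝒳₀, S₀, f₀, s, h𝒳₀, hS₀, hirr, hsm, hf, hgen, ⟨e⟩⟩ :=
    spreadingOut_smoothProjective_qbarFamily_holds σ hX
  refine ⟨𝒳₀, S₀, f₀, s, e, h𝒳₀, hS₀, hirr, hsm, hf, hgen, ?_⟩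
  -- the classical Betti–Hodge datum and the geometric VHS datum of `R²ᵖ f_* ℚ`
  obtain ⟨B, hBc, hT, hD⟩ := hC
  haveI : HodgeTensorFacts.{0, 0} := hT
  obtain ⟨D, hfin⟩ := hD σ f₀ n (2 * p) hf hirr hsm
  haveI : ∀ t, Module.Finite ℚ (D.V.fiber t) := hfin
  -- `s` is Hodge-generic in its `ℚ̄`-Zariski closure, which is everything
  have hHG := hG B hBc σ f₀ n (2 * p) D hirr hsm s
  have hW : (⋂₀ {Z | IsDefinedOverQbar σ S₀ Z ∧ s ∈ Z}) =
      (Set.univ : Set (ComplexPoints ((baseChangeHom σ).obj S₀))) := by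
    rw [Set.sInter_eq_univ]
    rintro Z ⟨hZ, hsZ⟩
    haveI : LocallyOfFiniteType S₀.hom := locallyOfFiniteType_of_isQuasiProjectiveOver hS₀
    exact hZ.eq_univ_of_closure_base_pt_eq_univ hsZ hgen
  rw [hW] at hHG
  -- finite monodromy orbit of the transported class `(e⁻¹)^* c` (rational, of type `(p,p)`)
  exact hB B hBc σ f₀ n p D h𝒳₀ hS₀ hirr hsm s hHG (complexBetti.map e.inv (2 * p) c) (hc.map _)
    (hh.map_of_iso e.symm)

/-- **DominantQbarEnvelope(n,p) ⟸ HGQ (stmt-11595) ∧ ClassicalGeometricVHS (stmt-11597)**, all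
`(n, p)`, modulo the named facts `bku_finite_monodromyOrbit_of_isHodgeGenericIn`,
`FundamentalGroup.riemannExistence_qbarDescent_of_finiteIndex`, `deligne_globalInvariantCycles`: for
a fixed `σ : ℚ̄ →+* ℂ`, every rational `(p,p)` class `c` on a smooth projective complex `n`-fold `X` is
`ι^* c'` for a `ℂ`-morphism `ι : X ⟶ W₀ ⊗_σ ℂ`, DOMINANT onto the `ℚ̄`-scheme `W₀` (whose
complexification is smooth projective), and a rational `(p,p)` class `c'` upstairs — the `ℚ̄`-spelled,
dominant form of the crux `QbarEnvelope.Envelope` (stmt-1069) of route `QbarEnvelope` (there `W` is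
asked over a NUMBER FIELD; the descent `ℚ̄ ↝ K` of a finite-type `ℚ̄`-scheme, EGA IV §8, is not in
the tree) and the real-carrier OUTPUT of Charles–Schnell Thm. 11.3.19. Spread
(`linearSystemTorelli_finiteMonodromyAtGenericSpread_of_qbarGenericIsHodgeGeneric`), take the dominant
envelope of the transported class (`stub_dominantEnvelopeOfFiniteMonodromy`, p119525) and precompose
with the spreading isomorphism. [cite: Voisin2007HodgeLoci, §3, proof of Prop. 0.7]
[cite: CharlesSchnell2014Notes, Thm. 11.3.19] -/
theorem linearSystemTorelli_dominantQbarEnvelope_of_qbarGenericIsHodgeGeneric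
    (hC : PeriodDeficiency.ClassicalGeometricVHS) (hG : PeriodDeficiency.QbarGenericIsHodgeGeneric)
    (hB : bku_finite_monodromyOrbit_of_isHodgeGenericIn)
    (hRE : Literature.AlgebraicGeometry.FundamentalGroup.riemannExistence_qbarDescent_of_finiteIndex)
    (hD : deligne_globalInvariantCycles) (σ : AlgebraicClosure ℚ →+* ℂ)
    {n : ℕ} {X : SchemeOver ℂ} (hX : IsSmoothProjective n X) (p : ℕ) (c : complexBetti X (2 * p))
    (hc : IsRationalClass c) (hh : IsOfHodgeType n X (2 * p) p p c) :
    ∃ (m : ℕ) (W₀ : SchemeOver (AlgebraicClosure ℚ)) (ι : X ⟶ (baseChangeHom σ).obj W₀)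
      (c' : complexBetti ((baseChangeHom σ).obj W₀) (2 * p)),
      IsSmoothProjective m ((baseChangeHom σ).obj W₀) ∧
      DenseRange (ι.left ≫ baseChangeHomFst σ W₀).base ∧
      IsRationalClass c' ∧ IsOfHodgeType m ((baseChangeHom σ).obj W₀) (2 * p) p p c' ∧
      complexBetti.map ι (2 * p) c' = c := by
  obtain ⟨𝒳₀, S₀, f₀, s, e, h𝒳₀, hS₀, hirr, hsm, hf, hgen, hfin⟩ :=
    linearSystemTorelli_finiteMonodromyAtGenericSpread_of_qbarGenericIsHodgeGeneric hC hG hB σ hX p c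
      hc hh
  obtain ⟨m, W₀, ι, c', hW, hdom, hc', hh', hmap⟩ :=
    stub_dominantEnvelopeOfFiniteMonodromy hRE hD σ f₀ n p h𝒳₀ hS₀ hirr hsm hf s hgen
      (complexBetti.map e.inv (2 * p) c) (hc.map _) (hh.map_of_iso e.symm) hfin
  refine ⟨m, W₀, e.hom ≫ ι, c', hW, ?_, hc', hh', ?_⟩
  · have hsurj : Function.Surjective e.hom.left.base := e.hom.left.surjective
    have : ((e.hom ≫ ι).left ≫ baseChangeHomFst σ W₀).base =
        e.hom.left.base ≫ (ι.left ≫ baseChangeHomFst σ W₀).base := rfl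
    rw [this, TopCat.coe_comp]
    exact hdom.comp hsurj.denseRange (ι.left ≫ baseChangeHomFst σ W₀).base.hom.continuous
  · rw [complexBetti.map_comp, ModuleCat.comp_apply, hmap]
    exact e.complexBetti_map_hom_map_inv (2 * p) c

/-- **DominantQbarEnvelope(4,2) ⟸ HGQ (stmt-11595) ∧ ClassicalGeometricVHS (stmt-11597)**, modulo
the named facts `bku_finite_monodromyOrbit_of_isHodgeGenericIn`,
`FundamentalGroup.riemannExistence_qbarDescent_of_finiteIndex`, `deligne_globalInvariantCycles`:
for a fixed `σ : ℚ̄ →+* ℂ`, every rational `(2,2)`-class `c` on a smooth projective complex fourfold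
`X` is `ι^* c'` for a `ℂ`-morphism `ι : X ⟶ W₀ ⊗_σ ℂ`, DOMINANT onto the `ℚ̄`-scheme `W₀` (whose
complexification is smooth projective), and a rational `(2,2)`-class `c'` upstairs — the `(4,2)`
instance of `linearSystemTorelli_dominantQbarEnvelope_of_qbarGenericIsHodgeGeneric`, in the exact
shape of the hypothesis `hE` of `linearSystemTorelli_middleDivisorSupportFourfold_of_dominantQbarEnvelope`.
[cite: Voisin2007HodgeLoci, §3, proof of Prop. 0.7] [cite: CharlesSchnell2014Notes, Thm. 11.3.19] -/
theorem linearSystemTorelli_dominantQbarEnvelopeFourfoldCodimTwo_of_qbarGenericIsHodgeGeneric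
    (hC : PeriodDeficiency.ClassicalGeometricVHS) (hG : PeriodDeficiency.QbarGenericIsHodgeGeneric)
    (hB : bku_finite_monodromyOrbit_of_isHodgeGenericIn)
    (hRE : Literature.AlgebraicGeometry.FundamentalGroup.riemannExistence_qbarDescent_of_finiteIndex)
    (hD : deligne_globalInvariantCycles) (σ : AlgebraicClosure ℚ →+* ℂ) :
    ∀ ⦃X : SchemeOver ℂ⦄, IsSmoothProjective 4 X → ∀ (c : complexBetti X 4), IsRationalClass c →
      IsOfHodgeType 4 X 4 2 2 c →
        ∃ (m : ℕ) (W₀ : SchemeOver (AlgebraicClosure ℚ)) (ι : X ⟶ (baseChangeHom σ).obj W₀)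
          (c' : complexBetti ((baseChangeHom σ).obj W₀) 4),
          IsSmoothProjective m ((baseChangeHom σ).obj W₀) ∧
          DenseRange (ι.left ≫ baseChangeHomFst σ W₀).base ∧
          IsRationalClass c' ∧ IsOfHodgeType m ((baseChangeHom σ).obj W₀) 4 2 2 c' ∧
          complexBetti.map ι 4 c' = c :=
  fun _ hX c hc hh ↦
    linearSystemTorelli_dominantQbarEnvelope_of_qbarGenericIsHodgeGeneric hC hG hB hRE hD σ hX 2 c hc hh

/-- **stmt-2409 ⟸ route `PeriodDeficiency`** (kernel-checked dedup): the crux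
`MiddleDivisorSupportFourfold` follows from `PeriodDeficiency.ClassicalGeometricVHS` (stmt-11597),
`PeriodDeficiency.QbarGenericIsHodgeGeneric` (stmt-11595) and `PeriodDeficiency.HodgeConjectureQbar`
(stmt-11596), modulo the named facts `bku_finite_monodromyOrbit_of_isHodgeGenericIn`,
`FundamentalGroup.riemannExistence_qbarDescent_of_finiteIndex`, `deligne_globalInvariantCycles` and
`charlesSchnell2014_algebraicClasses_supportedOn_qbarClosed` — Voisin's `ℚ̄`-funnel for divisor
support, with the glue proved (no Fulton). [cite: Voisin2007HodgeLoci, §3, proof of Prop. 0.7]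
[cite: CharlesSchnell2014Notes, Thm. 11.3.19 and Remark after Cor. 11.3.16] -/
theorem linearSystemTorelli_middleDivisorSupportFourfold_of_periodDeficiency :
    Summit.HodgeConjecture.HodgeConjecture.Theses.PeriodDeficiency.ClassicalGeometricVHS →
    Summit.HodgeConjecture.HodgeConjecture.Theses.PeriodDeficiency.QbarGenericIsHodgeGeneric →
    Summit.HodgeConjecture.HodgeConjecture.Theses.PeriodDeficiency.HodgeConjectureQbar →
    Literature.AlgebraicGeometry.HodgeTheory.bku_finite_monodromyOrbit_of_isHodgeGenericIn →
    Literature.AlgebraicGeometry.FundamentalGroup.riemannExistence_qbarDescent_of_finiteIndex →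
    Literature.AlgebraicGeometry.HodgeTheory.deligne_globalInvariantCycles →
    Literature.AlgebraicGeometry.HodgeTheory.charlesSchnell2014_algebraicClasses_supportedOn_qbarClosed →
    Summit.HodgeConjecture.HodgeConjecture.Theses.LinearSystemTorelli.MiddleDivisorSupportFourfold := by
  intro hC hG hQ hB hRE hD hF
  obtain ⟨σ⟩ := exists_ringHom_algebraicClosure_rat_complex
  exact linearSystemTorelli_middleDivisorSupportFourfold_of_dominantQbarEnvelope_of_hodgeConjectureQbar
    hF hQ σ
    (linearSystemTorelli_dominantQbarEnvelopeFourfoldCodimTwo_of_qbarGenericIsHodgeGeneric hC hG hB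
      hRE hD σ)

/-- **The same with only the codimension-2 slice of the Hodge conjecture over `ℚ̄`** (for one fixed
`σ`): rational `(2,2)`-classes on every smooth projective `W₀ ⊗_σ ℂ` algebraic — the exact `ℚ̄`-side
residue of the crux along this line. [cite: Voisin2007HodgeLoci, §3, proof of Prop. 0.7]
[cite: CharlesSchnell2014Notes, Thm. 11.3.19 and Remark after Cor. 11.3.16] -/
theorem linearSystemTorelli_middleDivisorSupportFourfold_of_qbarGenericIsHodgeGeneric_of_hcQbarCodimTwo
    (hC : PeriodDeficiency.ClassicalGeometricVHS) (hG : PeriodDeficiency.QbarGenericIsHodgeGeneric)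
    (hB : bku_finite_monodromyOrbit_of_isHodgeGenericIn)
    (hRE : Literature.AlgebraicGeometry.FundamentalGroup.riemannExistence_qbarDescent_of_finiteIndex)
    (hD : deligne_globalInvariantCycles)
    (hF : charlesSchnell2014_algebraicClasses_supportedOn_qbarClosed) (σ : AlgebraicClosure ℚ →+* ℂ)
    (hQ2 : ∀ ⦃m : ℕ⦄ ⦃W₀ : SchemeOver (AlgebraicClosure ℚ)⦄,
      IsSmoothProjective m ((baseChangeHom σ).obj W₀) →
        ∀ (c' : complexBetti ((baseChangeHom σ).obj W₀) 4), IsRationalClass c' →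
          IsOfHodgeType m ((baseChangeHom σ).obj W₀) 4 2 2 c' →
            c' ∈ algebraicClasses ((baseChangeHom σ).obj W₀) 2) :
    LinearSystemTorelli.MiddleDivisorSupportFourfold :=
  linearSystemTorelli_middleDivisorSupportFourfold_of_dominantQbarEnvelope σ
    (linearSystemTorelli_dominantQbarEnvelopeFourfoldCodimTwo_of_qbarGenericIsHodgeGeneric hC hG hB
      hRE hD σ)
    (linearSystemTorelli_qbarDivisorSupport_of_hcQbarCodimTwo hF σ hQ2)

end Summit.HodgeConjecture.HodgeConjecture.Theorems

end
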